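import Literature.NumberTheory.EllipticCurves.Greenberg1999.LocalH1DivisibleCyclotomic
import Literature.NumberTheory.EllipticCurves.Sprung2012.ColemanMaps
import HarnessLib

/-!
# Greenberg, *Iwasawa theory for p-adic representations* (Adv. Stud. Pure Math. 17, 1989), §3
# Corollary 2: over a `ℤ_p`-extension `K_∞` of a `p`-adic field `K`, if `A*(K_∞) = 0` then the Pontryagin
# dual `Ĥ¹(K_∞, A)` is a FREE `Λ`-module of rank `d[K:ℚ_p]` — ONE named fact, recorded for `A = E[p^∞]`
# of an elliptic curve `E/ℚ` over the local tower `ℚ_∞·ℚ_v` (`v ∣ p`), in the tree's DATA FORM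

Topic `Literature/NumberTheory/EllipticCurves`, cluster `Greenberg1989` (namespace = path). Statement-only:
one `def … : Prop`, nothing asserted, no instance / notation / attribute (D-0014). Typed for the
`bsd-2adic` cell (hand hK86-G of seat tower-1 GEN 65): it is link (2) of the PRINT ∘ KERNEL road to
K86 `H1IwPointsModelFreeAtTwo` (`Λ²`-freeness of Sprung's points model of `H¹_Iw(ℚ₂, T₂E)` at a good
supersingular prime `2`), the one displayed input of the registered stub `stub_flatKernelCyclic` of crux
`SupersingularRankZeroAtTwo` (stmt-BirchSwinnertonDyer-19097). Typed ≠ proved; BSD is proved for no curve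
by any of this.

## Source, verbatim ([Greenberg1989], held as `paper:greenberg2018-iwasawa-theory-p-adic-representations`)

§3, p. 109 (chunk p0013): "Let `K` be a finite extension of `ℚ_p` and let `K_∞` be some `ℤ_p`-extension of
`K`. We will consider a `G_K`-module `A` which is isomorphic to `(ℚ_p/ℤ_p)^d` as a group. `H¹(K_∞, A)` is a
discrete `Γ`-module (where `Γ = Gal(K_∞/K)`) and hence a `Λ`-module. … Here `A* = Hom_{ℤ_p}(T_A, μ_{p^∞})`,
where `T_A` denotes the Tate module for `A`. Also, for any field `𝒦` and any `G_𝒦`-module `M`, we use the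
notation `M(𝒦)` for `H⁰(G_𝒦, M)`. … Let `S` be a discrete `Γ`-module which is a `p`-primary abelian group.
Let `X = Ŝ = Hom_{ℤ_p}(S, ℚ_p/ℤ_p)`, which will be a compact `Λ`-module."
§3, p. 112 (chunk p0016 L8–9): "**Corollary 2.** If `A*(K_∞) = 0`, then `Ĥ¹(K_∞, A)` is a free `Λ`-module
of rank `d[K:ℚ_p]`." (Corollary of Prop. 1, `H¹(K_∞, A) ∼ Λ^r ⊕ A*(K_∞)^`, `r = [K:ℚ_p]d`, proved on
pp. 109–112 by Tate local duality and the Euler–Poincaré characteristic; no hypothesis on the reduction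
type, on `p`, or on which `ℤ_p`-extension.)
Restated for elliptic curves: [KitajimaOtsuki2018] Prop. 3.29 (arXiv:1607.03612 p. 16): "If
`E(K_∞)[p^∞] = 0`, then `H¹(K_∞, E[p^∞])^∨ ≅ Λ^{⊕ 2[K:ℚ_p]}`" (`A = E[p^∞]`, `d = 2`, and `A* ≅ E[p^∞]`
by the Weil pairing, so `A*(K_∞) = E(K_∞)[p^∞]`).

## The tree's reading (what the `def` below says, and why it is the printed statement)

* FIELDS. `K = ℚ_v = v.adicCompletion ℚ` for a place `v ∋ p` (so `[K:ℚ_p] = 1`), and `K_∞ = ℚ_∞·ℚ_v`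
  the local tower of a `ℤ_p`-extension `κ : ZpExtension ℚ p`: its absolute Galois group is the tree's
  `localSubgroup κ.kerSubgroup (v.adicCompletion ℚ) = Gal(ℚ̄_v / ℚ_∞·ℚ_v)` (file `SubgroupSelmer`; the
  chosen embedding `closureEmb`). The binder `hg : κ.IsTopGenerator (resGalOfEmb (closureEmb …) g)`
  (`κ(res g) = 1`) displays a local lift `g ∈ Γ_{ℚ_v}` of a topological generator `γ` of `Γ`; it makes
  `κ ∘ res : Γ_{ℚ_v} → ℤ_p` onto, i.e. `ℚ_∞·ℚ_v / ℚ_v` IS a `ℤ_p`-extension with group `Γ` — Greenberg's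
  "`K_∞` some `ℤ_p`-extension of `K`" — and fixes `Λ = ℤ_p⟦Γ⟧ ≅ ℤ_p⟦T⟧ = IwasawaAlgebra p`, `γ ↦ 1 + T`.
* MODULE. `A = E[p^∞] = E(ℚ̄_v)[p^∞] = AddCommGroup.primaryComponent (localPoints W (v.adicCompletion ℚ)) p`
  with its `Γ_{ℚ_v}`-action (`W` elliptic, so `A ≅ (ℚ_p/ℤ_p)²` as a group: `d = 2`), and
  `S = H¹(K_∞, A) = discreteH1 (localSubgroup κ.kerSubgroup (v.adicCompletion ℚ)) A` (continuous
  cohomology of the discrete module, exactly as in `Greenberg1999.localH1_primaryTorsion_divisible_cyclotomic`);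
  `γ` acts on `S` by `conjH1 … g` (file `SubgroupSelmer`: `(conj_g φ)(h) = g φ(g⁻¹ h g)`).
* HYPOTHESIS `A*(K_∞) = 0`, i.e. `E(ℚ_∞·ℚ_v)[p^∞] = 0`: no nonzero `p`-power-torsion point in Sprung's
  `localTowerPointsOfEmb κ (closureEmb …) W = E(ℚ̄_v)^{Gal(ℚ̄_v/ℚ_∞·ℚ_v)}` (file `Sprung2012/ColemanMaps`).
* CONCLUSION, DATA FORM. "`Ĥ¹(K_∞, A) = Hom(S, ℚ_p/ℤ_p)` with its compact `Λ`-module structure is `Λ`-free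
  of rank `d[K:ℚ_p] = 2`" is recorded exactly as the tree records the Iwasawa module `X(E/K_∞)`
  (`WeierstrassCurve.SelmerDualData`, file `IwasawaSelmer`; `FineSelmerDualData`, `TowerSignedSelmerDualData`):
  for EVERY `Λ`-module `X` given with an additive bijection `toDual : X → Hom(S, ℚ/ℤ)` (`ℚ/ℤ = AddCircle 1`;
  `Hom(S, ℚ_p/ℤ_p) = Hom(S, ℚ/ℤ)` since `S` is `p`-primary) under which `T` acts as `conj_g − 1`
  (`toDual (T • x) = toDual x ∘ conj_g − toDual x`, the convention of `SelmerDualData.toDual_T_smul`),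
  `X ≃ₗ[Λ] Λ²`. Such data exist (`IwasawaDual.IsLocNil.module` on `Hom(S, ℚ/ℤ)`, as in
  `IwasawaSelmerDualProofs`) and any two are isomorphic, so this is the printed sentence and nothing more.
  The companion identity `SelmerDualData.toDual_C_smul` (constants act through `ℤ_p → ℤ/p^k`) is NOT
  displayed because it FOLLOWS from the module axioms and additivity of `toDual` on the `p`-primary group
  `S`: for `p^k c = 0` and `a = a_k + p^k b` (`a_k = (toZModPow k a).val`),
  `toDual (C a • x) c = a_k • toDual x c + toDual (C b • x) (p^k c) = a_k • toDual x c`.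
  Either sign convention (`T ↦ conj_g − 1` or the contragredient `T ↦ conj_{g⁻¹} − 1`) gives a free module
  of the same rank (they differ by the automorphism `T ↦ (1+T)⁻¹ − 1` of `Λ`, or by `g ↦ g⁻¹`,
  `κ ↦ κ.unitTwist (−1)`); the tree's is used.
-- TODO(general form): any finite `K/ℚ_p`, any `ℤ_p`-extension `K_∞/K`, any `G_K`-module `A ≅ (ℚ_p/ℤ_p)^d`:
-- `A*(K_∞) = 0 ⟹ Ĥ¹(K_∞, A) ≅ Λ^{d[K:ℚ_p]}` ([Greenberg1989] §3 Cor. 2), and Prop. 1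
-- `H¹(K_∞, A) ∼ Λ^r ⊕ A*(K_∞)^` without the hypothesis; recorded: `K = ℚ_v` (`v ∣ p`, number field `ℚ`),
-- `K_∞ = ℚ_∞·ℚ_v`, `A = E[p^∞]` (`d = 2`, `A* = A`), the freeness corollary only.

## References
* [Greenberg1989] R. Greenberg, *Iwasawa theory for p-adic representations*, Adv. Stud. Pure Math. 17
  (1989) 97–137, §3, Prop. 1 (p. 109) and Corollary 2 (p. 112).
* [KitajimaOtsuki2018] T. Kitajima, R. Otsuki, *On the plus and the minus Selmer groups for elliptic curves
  at supersingular primes*, Tokyo J. Math. 41 (2018), Prop. 3.29 (arXiv:1607.03612, p. 16).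
* [GreenbergLNM1716] R. Greenberg, *Iwasawa theory for elliptic curves*, LNM 1716 (1999), §1 (the `Λ`-module
  structure `T = γ − 1` on `H¹(F_∞, E[p^∞])` and its Pontryagin dual).
-/

noncomputable section

open scoped Classical

open NumberField IsDedekindDomain Field Literature.NumberTheory.EllipticCurves
  Literature.NumberTheory.EllipticCurves.ZpExtension Literature.NumberTheory.EllipticCurves.Sprung2012

namespace Literature.NumberTheory.EllipticCurves.Greenberg1989

/-- **Greenberg 1989, §3 Corollary 2 (Adv. Stud. Pure Math. 17, p. 112), for `A = E[p^∞]` over the local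
tower `ℚ_∞·ℚ_v`, `v ∣ p`: if `E(ℚ_∞·ℚ_v)[p^∞] = 0` then the Pontryagin dual of `H¹(ℚ_∞·ℚ_v, E[p^∞])` is a
FREE `Λ`-module of rank `2 = d[ℚ_v:ℚ_p]`.** Verbatim: "Corollary 2. If `A*(K_∞) = 0`, then `Ĥ¹(K_∞, A)` is
a free `Λ`-module of rank `d[K:ℚ_p]`" (§3: "`K` a finite extension of `ℚ_p` … `K_∞` some `ℤ_p`-extension
of `K` … `A` … isomorphic to `(ℚ_p/ℤ_p)^d` … `A* = Hom_{ℤ_p}(T_A, μ_{p^∞})` … `X = Ŝ = Hom_{ℤ_p}(S, ℚ_p/ℤ_p)`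
… a compact `Λ`-module"); for elliptic curves (`A = A* = E[p^∞]` by the Weil pairing, `d = 2`):
Kitajima–Otsuki Prop. 3.29 "If `E(K_∞)[p^∞] = 0`, then `H¹(K_∞, E[p^∞])^∨ ≅ Λ^{⊕ 2[K:ℚ_p]}`".
In the tree's vocabulary (module docstring): for `W/ℚ` elliptic, `p` prime, `κ : ZpExtension ℚ p`, a place
`v ∋ p`, a local lift `g ∈ Γ_{ℚ_v}` of a topological generator (`hg : κ(res g) = 1`, so `ℚ_∞·ℚ_v/ℚ_v` is a
`ℤ_p`-extension with `Λ = ℤ_p⟦T⟧`, `res g ↦ 1 + T`), and EVERY `Λ`-module `X` identified by an additive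
bijection `toDual` with `Hom(H¹(Gal(ℚ̄_v/ℚ_∞·ℚ_v), E(ℚ̄_v)[p^∞]), ℚ/ℤ)` under which `T` acts as `conj_g − 1`
(DATA FORM of `WeierstrassCurve.SelmerDualData`; the constants identity `toDual_C_smul` is omitted — it
follows from the module axioms, see the module docstring): if `E(ℚ_∞·ℚ_v) = localTowerPointsOfEmb κ
(closureEmb …) W` has no nonzero `p`-power torsion, then `X ≃ₗ[Λ] Λ²`. Restriction of generality only
(`K = ℚ`, `A = E[p^∞]`); named fact, nothing asserted; NOT proved here (Tate local duality and the local
Euler–Poincaré characteristic formula are not in the tree).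
-- TODO(general form): finite `K/ℚ_p`, any `ℤ_p`-extension, any `A ≅ (ℚ_p/ℤ_p)^d`, rank `d[K:ℚ_p]`; and
-- Prop. 1 (`H¹(K_∞, A) ∼ Λ^r ⊕ A*(K_∞)^`) without the vanishing hypothesis.
[cite: Greenberg1989, §3 Corollary 2 (Adv. Stud. Pure Math. 17, p. 112); setup §3 p. 109 (held: paper:greenberg2018-iwasawa-theory-p-adic-representations, chunks p0013, p0016 L8–9)]
[cite: KitajimaOtsuki2018, Prop. 3.29 (arXiv:1607.03612 p. 16)]
[cite: GreenbergLNM1716, §1 (the Λ-action T = γ − 1 on H¹(F_∞, E[p^∞]) and its Pontryagin dual)] -/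
def localH1Dual_free_of_towerTorsion_trivial : Prop :=
  ∀ (W : WeierstrassCurve ℚ) [W.IsElliptic] (p : ℕ) [Fact p.Prime] (κ : ZpExtension ℚ p)
    (v : HeightOneSpectrum (𝓞 ℚ)) (_hpv : ((p : ℕ) : 𝓞 ℚ) ∈ v.asIdeal)
    (g : absoluteGaloisGroup (v.adicCompletion ℚ))
    (_hg : κ.IsTopGenerator (resGalOfEmb (closureEmb (K := ℚ) (v.adicCompletion ℚ)) g))
    (X : Type) [AddCommGroup X] [Module (IwasawaAlgebra p) X]
    (toDual : X →+ (discreteH1 (localSubgroup κ.kerSubgroup (v.adicCompletion ℚ))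
        (AddCommGroup.primaryComponent (localPoints W (v.adicCompletion ℚ)) p) →+ AddCircle (1 : ℚ)))
    (_hbij : Function.Bijective toDual)
    (_hT : ∀ (x : X) (c : discreteH1 (localSubgroup κ.kerSubgroup (v.adicCompletion ℚ))
        (AddCommGroup.primaryComponent (localPoints W (v.adicCompletion ℚ)) p)),
      toDual ((PowerSeries.X : IwasawaAlgebra p) • x) c =
        toDual x (conjH1 (localSubgroup κ.kerSubgroup (v.adicCompletion ℚ))
          (AddCommGroup.primaryComponent (localPoints W (v.adicCompletion ℚ)) p) g c) - toDual x c),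
    (∀ P ∈ localTowerPointsOfEmb κ (closureEmb (K := ℚ) (v.adicCompletion ℚ)) W,
        ∀ n : ℕ, p ^ n • P = 0 → P = 0) →
      Nonempty (X ≃ₗ[IwasawaAlgebra p] (Fin 2 → IwasawaAlgebra p))

end Literature.NumberTheory.EllipticCurves.Greenberg1989

end
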